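import Literature.IUT.LogVolume.Corollary22Statement
import Literature.NumberTheory.DiophantineGeometry.GenEllProjLineExamples
import HarnessLib

/-!
# [IUTchIV] Corollary 2.2: the hypotheses «support ∋ 2» + (∗^{j-inv}) are SATISFIABLE — a non-vacuity
# witness for the antecedent of the typed Corollary 2.2

S. Mochizuki, *Inter-universal Teichmüller theory IV*, RIMS manuscript (Apr. 2020) = PRIMS **57** (2021),
Corollary 2.2, p. 41: the compactly bounded subset `K_V ⊆ U_X(ℚ̄)` is assumed to have support containing the
nonarchimedean prime `2` and to satisfy «(∗^{j-inv}) … the image of the subset `K_v ⊆ U_X(ℚ̄_v)` … via the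
`j`-invariant … is a bounded subset of `𝔸¹(ℚ̄_v) = ℚ̄_v`» [claim: Mochizuki2012, status: disputed] (claim key,
D-0012; the content of THIS file is classical `2`-adic arithmetic). S. Mochizuki, *Arithmetic elliptic curves in
general position*, Math. J. Okayama Univ. **52** (2010), Example 1.3 (ii) p. 5 (compactly bounded subsets)
[cite: MochizukiGenEll2010, Ex 1.3 (ii) p.5].

Proof-only companion (abc-iut cell, wave 5, seat abc-iut-w5-d056; node IUTchIV:Cor2.2, support / non-vacuity)
of abc-iut-S3's typed statement `Literature.IUT.LogVolume.Cor22.Corollary22 Hunif := 0 < Hunif ∧ ∀ D : CBData,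
Hypotheses D → PartI D ∧ PartII D Hunif ∧ PartIII D Hunif` (`Corollary22Statement.lean`) — the hypothesis `h22`
of the campaign-S apex `Summit.ABC.IUTFork.ABC_of_corollary22_primes`. The structure
`Cor22.Hypotheses D` (fields `supp : D.SupportContains {2}`, `jinv : JInvBounded D`) is CONSUMED by eleven
tree theorems but no term of it is constructed anywhere in the tree (structure-inhabitation census of
abc-iut-w5-d056, 2026-08-26), so `Corollary22 Hunif` was, formally, not yet known to be non-vacuous. HERE:

* (private) `‖2‖ = 1/2`, `‖2⁻¹‖ = 2` in `ℚ̄_2`;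
* `Cor22.norm_eq_two_of_mem_stdNon`, `Cor22.norm_sub_one_eq_two_of_mem_stdNon` — on the standard bounding
  domain `K_2 = {‖y − 1/2‖ ≤ ‖2‖}` of abc-iut-S4's `CBData.std` (`GenEllProjLineExamples.lean`) one has
  `‖y‖ = ‖y − 1‖ = 2` (ultrametric inequality);
* `Cor22.norm_jInv_le_of_mem_stdNon` — hence `‖j(y)‖ = ‖2^8 (y²−y+1)³ / (y²(y−1)²)‖ ≤ 1` on `K_2`;
* `Cor22.jInvBounded_std`, `Cor22.hypotheses_std` — (∗^{j-inv}) and `Hypotheses` HOLD for `CBData.std S hS`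
  whenever `2 ∈ S`;
* `Cor22.exists_hypotheses` — **`∃ D : CBData, Hypotheses D`**, and `Cor22.exists_hypotheses_mem` — the same
  with a rational point (`λ = 1/2`) in `K_V`, so the domain quantified over in Cor. 2.2 (ii)/(iii) is not empty.

No definitions, no new named fact; nothing here bears on the disputed [IUTchIII] Cor. 3.12 or asserts any
clause of [IUTchIV] Cor. 2.2 itself; typed ≠ proved.
-/

noncomputable section

namespace Literature.IUT.LogVolume

namespace Cor22

open Metric Literature.NumberTheory.DiophantineGeometry.GenEll

/-- `‖2‖ = 2⁻¹` in `ℚ̄_2 = PadicAlgCl 2` (the spectral norm extends the `2`-adic norm). [folklore] -/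
private theorem norm_two_padicAlgCl_two : ‖(2 : PadicAlgCl 2)‖ = 2⁻¹ := by
  have h : (2 : PadicAlgCl 2) = (((2 : ℕ) : ℚ_[2]) : PadicAlgCl 2) := by
    rw [map_natCast]; norm_num
  rw [h, PadicAlgCl.norm_extends, Padic.norm_p]
  norm_num

/-- `‖2⁻¹‖ = 2` in `ℚ̄_2`. [folklore] -/
private theorem norm_inv_two_padicAlgCl_two : ‖(2 : PadicAlgCl 2)⁻¹‖ = 2 := by
  rw [norm_inv, norm_two_padicAlgCl_two, inv_inv]

/-- On the standard bounding domain `K_2 = {y : ‖y − 1/2‖ ≤ ‖2‖}` of `CBData.std`: `‖y‖ = 2`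
(ultrametric: `‖y − 1/2‖ ≤ 1/2 < 2 = ‖1/2‖`). [cite: MochizukiGenEll2010, Ex 1.3 (ii) p.5] -/
theorem norm_eq_two_of_mem_stdNon {y : PadicAlgCl 2} (hy : y ∈ CBData.stdNon 2) : ‖y‖ = 2 := by
  rw [CBData.stdNon, mem_closedBall, dist_eq_norm, Nat.cast_ofNat, norm_two_padicAlgCl_two] at hy
  have hne : ‖y - 2⁻¹‖ ≠ ‖(2 : PadicAlgCl 2)⁻¹‖ := by
    rw [norm_inv_two_padicAlgCl_two]; intro h; rw [h] at hy; norm_num at hy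
  have := IsUltrametricDist.norm_add_eq_max_of_norm_ne_norm hne
  rw [sub_add_cancel] at this
  rw [this, norm_inv_two_padicAlgCl_two]
  exact max_eq_right (by linarith)

/-- On the same domain: `‖y − 1‖ = 2` (`y − 1 = (y − 1/2) − 1/2`). [cite: MochizukiGenEll2010, Ex 1.3 (ii) p.5] -/
theorem norm_sub_one_eq_two_of_mem_stdNon {y : PadicAlgCl 2} (hy : y ∈ CBData.stdNon 2) : ‖y - 1‖ = 2 := by
  rw [CBData.stdNon, mem_closedBall, dist_eq_norm, Nat.cast_ofNat, norm_two_padicAlgCl_two] at hy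
  have hhalf : (1 : PadicAlgCl 2) = 2⁻¹ + 2⁻¹ := by norm_num
  have hrw : y - 1 = (y - 2⁻¹) + (-(2 : PadicAlgCl 2)⁻¹) := by rw [hhalf]; ring
  have hne : ‖y - 2⁻¹‖ ≠ ‖-(2 : PadicAlgCl 2)⁻¹‖ := by
    rw [norm_neg, norm_inv_two_padicAlgCl_two]; intro h; rw [h] at hy; norm_num at hy
  have := IsUltrametricDist.norm_add_eq_max_of_norm_ne_norm hne
  rw [← hrw] at this
  rw [this, norm_neg, norm_inv_two_padicAlgCl_two]
  exact max_eq_right (by linarith)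

/-- **(∗^{j-inv}) on the standard domain**: for `y ∈ K_2 = {‖y − 1/2‖ ≤ ‖2‖}` one has
`‖j(y)‖ = ‖2‖⁸ · ‖y² − y + 1‖³ / (‖y‖² · ‖y − 1‖²) ≤ 2⁻⁸ · 7³ / 16 ≤ 1`
(`j(λ) = 2⁸(λ²−λ+1)³/(λ²(λ−1)²)`, `Cor22.jInv`). [cite: Mochizuki2012, IUTchIV Cor 2.2 p.41] -/
theorem norm_jInv_le_of_mem_stdNon {y : PadicAlgCl 2} (hy : y ∈ CBData.stdNon 2) : ‖jInv y‖ ≤ 1 := by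
  have hy0 : ‖y‖ = 2 := norm_eq_two_of_mem_stdNon hy
  have hy1 : ‖y - 1‖ = 2 := norm_sub_one_eq_two_of_mem_stdNon hy
  have hnum : ‖y ^ 2 - y + 1‖ ≤ 7 := by
    calc ‖y ^ 2 - y + 1‖ ≤ ‖y ^ 2 - y‖ + ‖(1 : PadicAlgCl 2)‖ := norm_add_le _ _
      _ ≤ ‖y ^ 2‖ + ‖y‖ + ‖(1 : PadicAlgCl 2)‖ := by gcongr; exact norm_sub_le _ _
      _ = 7 := by rw [norm_pow, hy0, norm_one]; norm_num
  have hden : ‖y ^ 2 * (y - 1) ^ 2‖ = 16 := by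
    rw [norm_mul, norm_pow, norm_pow, hy0, hy1]; norm_num
  rw [jInv, norm_div, norm_mul, norm_pow, norm_pow, norm_two_padicAlgCl_two, hden]
  have h3 : ‖y ^ 2 - y + 1‖ ^ 3 ≤ 7 ^ 3 := by gcongr
  rw [div_le_one (by norm_num)]
  nlinarith [h3, norm_nonneg (y ^ 2 - y + 1)]

/-- **(∗^{j-inv}) holds for the standard compactly bounded subset** `CBData.std S hS` (its `K_2` is the ball
`‖y − 1/2‖ ≤ ‖2‖` whatever `S` is). [cite: Mochizuki2012, IUTchIV Cor 2.2 p.41] -/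
theorem jInvBounded_std (S : Finset ℕ) (hS : ∀ p ∈ S, p.Prime) : JInvBounded (CBData.std S hS) :=
  ⟨1, fun _ hy => norm_jInv_le_of_mem_stdNon hy⟩

/-- **Both hypotheses of [IUTchIV] Cor. 2.2 hold for `CBData.std S hS` as soon as `2 ∈ S`.**
[cite: Mochizuki2012, IUTchIV Cor 2.2 p.41] -/
theorem hypotheses_std (S : Finset ℕ) (hS : ∀ p ∈ S, p.Prime) (h2 : 2 ∈ S) :
    Hypotheses (CBData.std S hS) :=
  ⟨Finset.singleton_subset_iff.mpr h2, jInvBounded_std S hS⟩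

/-- **NON-VACUITY of the antecedent of the typed [IUTchIV] Cor. 2.2**: some compactly bounded subset has
support containing `2` and satisfies (∗^{j-inv}). [cite: Mochizuki2012, IUTchIV Cor 2.2 p.41] -/
theorem exists_hypotheses : ∃ D : CBData, Hypotheses D :=
  ⟨CBData.std {2} (by simp [Nat.prime_two]), hypotheses_std _ _ (Finset.mem_singleton_self 2)⟩

/-- The same witness is INHABITED by a rational point (`λ = 1/2`, abc-iut-S4's `CBData.ratPoint_half_mem`), so
the domain `K_V ∩ U_X(ℚ̄)^{≤ d}` quantified over in Cor. 2.2 (ii)(iii) is nonempty for this `K_V`.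
[cite: MochizukiGenEll2010, Ex 1.3 (ii) p.6] -/
theorem exists_hypotheses_mem :
    ∃ D : CBData, Hypotheses D ∧ ratPoint 2⁻¹ ∈ D.toSet :=
  ⟨CBData.std {2} (by simp [Nat.prime_two]), hypotheses_std _ _ (Finset.mem_singleton_self 2),
    CBData.ratPoint_half_mem _ _⟩

end Cor22

end Literature.IUT.LogVolume

end
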